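import Summits.ABC.StewartYu.KappaDoorSlot
import HarnessLib

/-!
# Cell abc-stewartyu, route M2⁻ (`PadicPrimesYuNinetyOddRadOne`, staged): the ODD TRANSFER —
# Yu 1990 at `p ≡ 3 (mod 4)` and at `p ≡ 1 (mod 4)` give one odd `p`-adic slot of the κ-door with
# `(κ, σ, τ, τ₁) = (1, 2, 1, 1)`

`Summits/ABC/StewartYu/YuNinetyOddTransfer.lean` — cell `abc-stewartyu` (HOME
`run/shared/lean/pub/abc-stewartyu/`, seat p3; theorems only, no definition, no named fact).

The planner's staged rung route A1.M2⁻ (HOME/plan/routes/RouteM2minus.md, routeM2minus.json;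
STATUS 2026-08-26T03:27:58Z) re-threads the two odd-prime cruxes `YuNinetyThreeModFour`
(stmt-ABC-19249) and `YuNinetyOneModFour` (stmt-ABC-19250) of route `PadicPrimesYuNinety` through
the cell's landed odd κ-door (`KappaDoor.epsShape_of_oddFinBound`, item `OddKappaDoorSpec` closed)
to the leaf `EpsShapeBoundOne` (`log c ≪_ε rad(abc)^{1+ε}`) WITHOUT the `2`-adic engine. Its one
new support item is the bookkeeping `OddTransferSpec`: the two residue-class estimates (Finset form,
strict, `(c₅ #S)^{#S} · p² · log B · log log max(4, max S) · ∏ log max(4, q)`) give, at every odd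
prime `p`, the κ-door's `Fin`-indexed input `KappaDoor.FinBoundAt p K L 1 2 1 1` with `K = 2`,
`L = 2 · max(1, |c₅|, |c₅'|)`:

* `S = image q`, `e` extended by zero off the image (`Function.extend`), `B = max(3, max |eᵢ|)`;
* `(c₅ n)ⁿ ≤ (max(1,|c₅|,|c₅'|))ⁿ · nⁿ`; `log max(4, q) ≤ 2 log q` for a prime `q`;
  `log log max(4, max S) ≤ log max(4, ∏ qᵢ) ≤ 2 log max(3, ∏ qᵢ)`; every odd prime is `≡ 1` or
  `≡ 3 (mod 4)`.

Main result: `YuNinetyOdd.oddTransferSpec_holds`, whose statement is VERBATIM the text of the staged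
item `OddTransferSpec` (so that the item closes by `exact oddTransferSpec_holds` the minute the route
is born), and the unbundled form `YuNinetyOdd.finBoundAt_of_residueClasses` it is assembled from.
Everything is [folklore] bookkeeping; nothing here is claimed to be in print. WHAT THIS IS NOT: no
`p`-adic estimate is proved here — both residue-class estimates are hypotheses.
-/

noncomputable section

open Finset Real

namespace Summit.ABC.StewartYu

namespace YuNinetyOdd

open KappaDoor

/-- The residue-class estimate of route `PadicPrimesYuNinety` at the primes `p ≡ a (mod 4)` with
constant `c₅` (the common body of the cruxes `YuNinetyThreeModFour` (`a = 3`) and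
`YuNinetyOneModFour` (`a = 1`), unbundled from its `∃ c₅`). [folklore] -/
theorem finBoundAt_of_residueClass_aux {p : ℕ} (hp : p.Prime) {c₅ : ℝ}
    (hY : ∀ (S : Finset ℕ), (∀ q ∈ S, q.Prime) → p ∉ S → S.Nonempty →
      ∀ (e : ℕ → ℤ) (B : ℝ), 3 ≤ B → (∀ q ∈ S, (|e q| : ℝ) ≤ B) → ∏ q ∈ S, (q : ℚ) ^ e q ≠ 1 →
      (padicValRat p (∏ q ∈ S, (q : ℚ) ^ e q - 1) : ℝ) <
        (c₅ * S.card) ^ S.card * (p : ℝ) ^ 2 * Real.log B *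
          Real.log (Real.log ((max 4 (S.sup id) : ℕ) : ℝ)) * ∏ q ∈ S, Real.log ((max 4 q : ℕ) : ℝ))
    {c : ℝ} (hc1 : 1 ≤ c) (hc : |c₅| ≤ c) :
    FinBoundAt p 2 (2 * c) 1 2 1 1 := by
  classical
  intro n q e hq hinj hqp he hne1
  -- `n ≥ 1`
  have hn : 1 ≤ n := by
    rcases Nat.eq_zero_or_pos n with h0 | h0
    · subst h0; exact absurd (funext fun i => Fin.elim0 i) he
    · exact h0
  -- the Finset data
  set S : Finset ℕ := Finset.univ.image q with hS
  set e' : ℕ → ℤ := Function.extend q e 0 with he'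
  have he'q : ∀ i, e' (q i) = e i := fun i => hinj.extend_apply e 0 i
  have hSprime : ∀ m ∈ S, m.Prime := by
    intro m hm
    obtain ⟨i, -, rfl⟩ := Finset.mem_image.mp hm
    exact hq i
  have hpS : p ∉ S := by
    intro hm
    obtain ⟨i, -, hi⟩ := Finset.mem_image.mp hm
    exact hqp i hi
  have hSne : S.Nonempty := ⟨q ⟨0, hn⟩, Finset.mem_image.mpr ⟨⟨0, hn⟩, Finset.mem_univ _, rfl⟩⟩
  have hcard : S.card = n := by
    rw [hS, Finset.card_image_of_injective _ hinj, Finset.card_univ, Fintype.card_fin]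
  -- the exponent bound `B`
  set Bn : ℕ := max 3 (Finset.univ.sup fun i => (e i).natAbs) with hBn
  set B : ℝ := (Bn : ℝ) with hB
  have hB3 : (3 : ℝ) ≤ B := by
    rw [hB, hBn]; exact_mod_cast le_max_left _ _
  have heB : ∀ m ∈ S, (|e' m| : ℝ) ≤ B := by
    intro m hm
    obtain ⟨i, -, rfl⟩ := Finset.mem_image.mp hm
    rw [he'q i, hB, hBn]
    have h1 : (e i).natAbs ≤ Finset.univ.sup fun i => (e i).natAbs :=
      Finset.le_sup (f := fun i => (e i).natAbs) (Finset.mem_univ i)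
    have h3 : ((e i).natAbs : ℝ) = |(e i : ℝ)| := by
      rw [Nat.cast_natAbs, Int.cast_abs]
    rw [← h3]
    exact_mod_cast h1.trans (le_max_right _ _)
  -- the products over `S` are the products over `Fin n`
  have hprodQ : ∏ m ∈ S, (m : ℚ) ^ e' m = ∏ i, (q i : ℚ) ^ e i := by
    rw [hS, Finset.prod_image fun i _ j _ h => hinj h]
    exact Finset.prod_congr rfl fun i _ => by rw [he'q i]
  have hprodLog : ∏ m ∈ S, Real.log ((max 4 m : ℕ) : ℝ) = ∏ i, Real.log ((max 4 (q i) : ℕ) : ℝ) := by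
    rw [hS, Finset.prod_image fun i _ j _ h => hinj h]
  have hne1' : ∏ m ∈ S, (m : ℚ) ^ e' m ≠ 1 := by rwa [hprodQ]
  -- the residue-class estimate
  have key := hY S hSprime hpS hSne e' B hB3 heB hne1'
  rw [hprodQ, hcard, hprodLog] at key
  -- positivity of the factors
  have hq2 : ∀ i, 2 ≤ q i := fun i => (hq i).two_le
  have hlogq : ∀ i, 0 < Real.log (q i) := fun i =>
    Real.log_pos (by exact_mod_cast lt_of_lt_of_le (by norm_num) (hq2 i))
  have hPlog : 0 < ∏ i, Real.log (q i : ℝ) := Finset.prod_pos fun i _ => hlogq i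
  have hlogB : 0 < Real.log B := Real.log_pos (by linarith)
  set P : ℕ := ∏ i, q i with hP
  have hP1 : 1 ≤ P := by
    rw [hP]; exact Finset.one_le_prod' fun i _ => le_trans (by norm_num) (hq2 i)
  have hlogM : 0 < Real.log (max 3 (P : ℝ)) :=
    Real.log_pos (lt_of_lt_of_le (by norm_num) (le_max_left _ _))
  have hpR : (0 : ℝ) < (p : ℝ) ^ 2 := by
    have := hp.pos; positivity
  -- (1) `(c₅ n)ⁿ ≤ cⁿ nⁿ`
  have h1 : (c₅ * n) ^ n ≤ c ^ n * (n : ℝ) ^ n := by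
    calc (c₅ * n) ^ n ≤ |(c₅ * n) ^ n| := le_abs_self _
      _ = (|c₅| * n) ^ n := by rw [abs_pow, abs_mul, Nat.abs_cast]
      _ ≤ (c * n) ^ n := pow_le_pow_left₀ (by positivity) (by gcongr) n
      _ = c ^ n * (n : ℝ) ^ n := mul_pow _ _ _
  -- (2) `log max(4, q) ≤ 2 log q`
  have h2 : ∀ i, Real.log ((max 4 (q i) : ℕ) : ℝ) ≤ 2 * Real.log (q i) := by
    intro i
    have hq2' : (2 : ℝ) ≤ q i := by exact_mod_cast hq2 i
    have hle : ((max 4 (q i) : ℕ) : ℝ) ≤ (q i : ℝ) ^ 2 := by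
      rcases le_or_gt 4 (q i) with h | h
      · rw [max_eq_right h]
        have h4 : (4 : ℝ) ≤ q i := by exact_mod_cast h
        nlinarith
      · rw [max_eq_left h.le]; push_cast; nlinarith
    calc Real.log ((max 4 (q i) : ℕ) : ℝ) ≤ Real.log ((q i : ℝ) ^ 2) :=
          Real.log_le_log (by positivity) hle
      _ = 2 * Real.log (q i) := by rw [Real.log_pow]; push_cast; ring
  have h2' : ∏ i, Real.log ((max 4 (q i) : ℕ) : ℝ) ≤ 2 ^ n * ∏ i, Real.log (q i : ℝ) := by
    calc ∏ i, Real.log ((max 4 (q i) : ℕ) : ℝ) ≤ ∏ i, (2 * Real.log (q i : ℝ)) :=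
          Finset.prod_le_prod (fun i _ => Real.log_nonneg (by
            have : (4 : ℝ) ≤ ((max 4 (q i) : ℕ) : ℝ) := by exact_mod_cast le_max_left _ _
            linarith)) fun i _ => h2 i
      _ = 2 ^ n * ∏ i, Real.log (q i : ℝ) := by
          rw [Finset.prod_mul_distrib, Finset.prod_const, Finset.card_univ, Fintype.card_fin]
  have hlog4pos : 0 ≤ ∏ i, Real.log ((max 4 (q i) : ℕ) : ℝ) :=
    Finset.prod_nonneg fun i _ => Real.log_nonneg (by
      have : (4 : ℝ) ≤ ((max 4 (q i) : ℕ) : ℝ) := by exact_mod_cast le_max_left _ _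
      linarith)
  -- (3) `log log max(4, max S) ≤ 2 log max(3, ∏ qᵢ)`
  have hsupP : S.sup id ≤ P := by
    refine Finset.sup_le fun m hm => ?_
    obtain ⟨i, -, rfl⟩ := Finset.mem_image.mp hm
    rw [hP, id]
    exact Nat.le_of_dvd (lt_of_lt_of_le Nat.zero_lt_one hP1) (Finset.dvd_prod_of_mem q (mem_univ i))
  have hA4 : (4 : ℝ) ≤ ((max 4 (S.sup id) : ℕ) : ℝ) := by exact_mod_cast le_max_left _ _
  have hAle : ((max 4 (S.sup id) : ℕ) : ℝ) ≤ (4 / 3) * max 3 (P : ℝ) := by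
    rcases le_or_gt 4 (S.sup id) with h | h
    · rw [max_eq_right h]
      have : ((S.sup id : ℕ) : ℝ) ≤ (P : ℝ) := by exact_mod_cast hsupP
      calc ((S.sup id : ℕ) : ℝ) ≤ (P : ℝ) := this
        _ ≤ max 3 (P : ℝ) := le_max_right _ _
        _ ≤ (4 / 3) * max 3 (P : ℝ) := by
            have : 0 ≤ max 3 (P : ℝ) := le_trans (by norm_num) (le_max_left _ _)
            linarith
    · rw [max_eq_left h.le]; push_cast
      have : (3 : ℝ) ≤ max 3 (P : ℝ) := le_max_left _ _
      linarith
  have h3 : Real.log (Real.log ((max 4 (S.sup id) : ℕ) : ℝ)) ≤ 2 * Real.log (max 3 (P : ℝ)) := by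
    have hlogA : 0 < Real.log ((max 4 (S.sup id) : ℕ) : ℝ) := Real.log_pos (by linarith)
    -- `log log A ≤ log A − 1 ≤ log(4/3) + log max(3,P) − 1 ≤ log max(3,P)`
    have hM3 : (3 : ℝ) ≤ max 3 (P : ℝ) := le_max_left _ _
    calc Real.log (Real.log ((max 4 (S.sup id) : ℕ) : ℝ))
        ≤ Real.log ((max 4 (S.sup id) : ℕ) : ℝ) - 1 := Real.log_le_sub_one_of_pos hlogA
      _ ≤ Real.log ((4 / 3) * max 3 (P : ℝ)) - 1 := by
          gcongr
      _ = Real.log (4 / 3) + Real.log (max 3 (P : ℝ)) - 1 := by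
          rw [Real.log_mul (by norm_num) (by positivity)]
      _ ≤ Real.log (max 3 (P : ℝ)) := by
          have : Real.log (4 / 3) ≤ 4 / 3 - 1 := Real.log_le_sub_one_of_pos (by norm_num)
          linarith
      _ ≤ 2 * Real.log (max 3 (P : ℝ)) := by linarith
  have hloglogpos : 0 < Real.log (Real.log ((max 4 (S.sup id) : ℕ) : ℝ)) := by
    apply Real.log_pos
    have h4 : Real.log 4 ≤ Real.log ((max 4 (S.sup id) : ℕ) : ℝ) :=
      Real.log_le_log (by norm_num) hA4
    have : (1 : ℝ) < Real.log 4 := by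
      have h := Real.exp_one_lt_d9
      have : Real.exp 1 < 4 := by linarith
      calc (1 : ℝ) = Real.log (Real.exp 1) := (Real.log_exp 1).symm
        _ < Real.log 4 := Real.log_lt_log (Real.exp_pos 1) this
    linarith
  -- assemble
  have hP' : (max 3 (∏ i, ((q i : ℕ) : ℝ))) = max 3 (P : ℝ) := by rw [hP]; push_cast; rfl
  rw [hP', pow_one, pow_one, one_mul, Real.rpow_natCast, Real.rpow_two]
  have step : (c₅ * n) ^ n * (p : ℝ) ^ 2 * Real.log B *
      Real.log (Real.log ((max 4 (S.sup id) : ℕ) : ℝ)) * ∏ i, Real.log ((max 4 (q i) : ℕ) : ℝ) ≤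
      2 * (2 * c) ^ n * (n : ℝ) ^ n * (p : ℝ) ^ 2 * (∏ i, Real.log (q i : ℝ)) * Real.log B *
        Real.log (max 3 (P : ℝ)) := by
    calc (c₅ * n) ^ n * (p : ℝ) ^ 2 * Real.log B *
          Real.log (Real.log ((max 4 (S.sup id) : ℕ) : ℝ)) * ∏ i, Real.log ((max 4 (q i) : ℕ) : ℝ)
        ≤ (c ^ n * (n : ℝ) ^ n) * (p : ℝ) ^ 2 * Real.log B *
          (2 * Real.log (max 3 (P : ℝ))) * (2 ^ n * ∏ i, Real.log (q i : ℝ)) := by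
          gcongr
      _ = 2 * (2 * c) ^ n * (n : ℝ) ^ n * (p : ℝ) ^ 2 * (∏ i, Real.log (q i : ℝ)) * Real.log B *
          Real.log (max 3 (P : ℝ)) := by rw [mul_pow]; ring
  have hB' : B = max (3 : ℝ) (((Finset.univ.sup fun i => (e i).natAbs : ℕ) : ℕ) : ℝ) := by
    rw [hB, hBn, Nat.cast_max]; push_cast; rfl
  rw [← hB']
  exact (key.le.trans step)

/-- **The odd transfer, unbundled.** If Yu's 1990 estimate for rational primes holds at the primes
`p ≡ 3 (mod 4)` with constant `c₅` and at the primes `p ≡ 1 (mod 4)` with constant `c₅'` (the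
bodies of the cruxes `YuNinetyThreeModFour`, `YuNinetyOneModFour` of route `PadicPrimesYuNinety`),
then at EVERY odd prime `p` the κ-door's one-prime input `FinBoundAt p K L 1 2 1 1` holds with
`K = 2`, `L = 2 · max(1, max(|c₅|, |c₅'|))`. [folklore] -/
theorem finBoundAt_of_residueClasses {c₅ c₅' : ℝ}
    (h₃ : ∀ (p : ℕ), p.Prime → p % 4 = 3 → ∀ (S : Finset ℕ), (∀ q ∈ S, q.Prime) → p ∉ S →
      S.Nonempty → ∀ (e : ℕ → ℤ) (B : ℝ), 3 ≤ B → (∀ q ∈ S, (|e q| : ℝ) ≤ B) →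
      ∏ q ∈ S, (q : ℚ) ^ e q ≠ 1 →
      (padicValRat p (∏ q ∈ S, (q : ℚ) ^ e q - 1) : ℝ) <
        (c₅ * S.card) ^ S.card * (p : ℝ) ^ 2 * Real.log B *
          Real.log (Real.log ((max 4 (S.sup id) : ℕ) : ℝ)) * ∏ q ∈ S, Real.log ((max 4 q : ℕ) : ℝ))
    (h₁ : ∀ (p : ℕ), p.Prime → p % 4 = 1 → ∀ (S : Finset ℕ), (∀ q ∈ S, q.Prime) → p ∉ S →
      S.Nonempty → ∀ (e : ℕ → ℤ) (B : ℝ), 3 ≤ B → (∀ q ∈ S, (|e q| : ℝ) ≤ B) →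
      ∏ q ∈ S, (q : ℚ) ^ e q ≠ 1 →
      (padicValRat p (∏ q ∈ S, (q : ℚ) ^ e q - 1) : ℝ) <
        (c₅' * S.card) ^ S.card * (p : ℝ) ^ 2 * Real.log B *
          Real.log (Real.log ((max 4 (S.sup id) : ℕ) : ℝ)) * ∏ q ∈ S, Real.log ((max 4 q : ℕ) : ℝ))
    {p : ℕ} (hp : p.Prime) (hp2 : p ≠ 2) :
    FinBoundAt p 2 (2 * max 1 (max |c₅| |c₅'|)) 1 2 1 1 := by
  have hc1 : (1 : ℝ) ≤ max 1 (max |c₅| |c₅'|) := le_max_left _ _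
  have hndvd : ¬ 2 ∣ p := fun hd =>
    hp2 ((hp.eq_one_or_self_of_dvd 2 hd).resolve_left (by norm_num)).symm
  have hodd : p % 4 = 1 ∨ p % 4 = 3 := by omega
  rcases hodd with h | h
  · exact finBoundAt_of_residueClass_aux hp (h₁ p hp h) hc1
      ((le_max_right _ _).trans (le_max_right _ _))
  · exact finBoundAt_of_residueClass_aux hp (h₃ p hp h) hc1
      ((le_max_left _ _).trans (le_max_right _ _))

/-- **The odd transfer (item `OddTransferSpec` of the staged rung route A1.M2⁻
`PadicPrimesYuNinetyOddRadOne`, verbatim).** The two residue-class estimates of Yu 1990 for rational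
primes (`p ≡ 3 (mod 4)` and `p ≡ 1 (mod 4)`, each with its own constant) give constants `K ≥ 0`,
`L ≥ 1` such that at every odd prime `p` the κ-door's `Fin`-indexed one-prime bound holds with
`(κ, σ, τ, τ₁) = (1, 2, 1, 1)`: `ord_p(∏ qᵢ^{eᵢ} − 1) ≤ K·Lⁿ·nⁿ·p²·(∏ log qᵢ)·log max(3, max|eᵢ|)·
log max(3, ∏ qᵢ)` (`K = 2`, `L = 2·max(1, |c₅|, |c₅'|)`). [folklore] -/
theorem oddTransferSpec_holds :
    (∃ c₅ : ℝ, ∀ (p : ℕ), p.Prime → p % 4 = 3 → ∀ (S : Finset ℕ), (∀ q ∈ S, q.Prime) → p ∉ S →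
      S.Nonempty → ∀ (e : ℕ → ℤ) (B : ℝ), 3 ≤ B → (∀ q ∈ S, (|e q| : ℝ) ≤ B) →
      ∏ q ∈ S, (q : ℚ) ^ e q ≠ 1 →
      (padicValRat p (∏ q ∈ S, (q : ℚ) ^ e q - 1) : ℝ) <
        (c₅ * S.card) ^ S.card * (p : ℝ) ^ 2 * Real.log B *
          Real.log (Real.log ((max 4 (S.sup id) : ℕ) : ℝ)) * ∏ q ∈ S, Real.log ((max 4 q : ℕ) : ℝ)) →
    (∃ c₅ : ℝ, ∀ (p : ℕ), p.Prime → p % 4 = 1 → ∀ (S : Finset ℕ), (∀ q ∈ S, q.Prime) → p ∉ S →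
      S.Nonempty → ∀ (e : ℕ → ℤ) (B : ℝ), 3 ≤ B → (∀ q ∈ S, (|e q| : ℝ) ≤ B) →
      ∏ q ∈ S, (q : ℚ) ^ e q ≠ 1 →
      (padicValRat p (∏ q ∈ S, (q : ℚ) ^ e q - 1) : ℝ) <
        (c₅ * S.card) ^ S.card * (p : ℝ) ^ 2 * Real.log B *
          Real.log (Real.log ((max 4 (S.sup id) : ℕ) : ℝ)) * ∏ q ∈ S, Real.log ((max 4 q : ℕ) : ℝ)) →
    ∃ (K L : ℝ), 0 ≤ K ∧ 1 ≤ L ∧ ∀ p, p.Prime → p ≠ 2 →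
      (∀ (n : ℕ) (q : Fin n → ℕ) (e : Fin n → ℤ), (∀ i, (q i).Prime) → Function.Injective q →
        (∀ i, q i ≠ p) → e ≠ 0 → ∏ i, ((q i : ℚ)) ^ e i ≠ 1 →
        (padicValRat p (∏ i, ((q i : ℚ)) ^ e i - 1) : ℝ) ≤
          K * L ^ n * (n : ℝ) ^ ((1 : ℝ) * n) * (p : ℝ) ^ (2 : ℝ) * (∏ i, Real.log (q i)) *
            Real.log (max 3 ((Finset.univ.sup fun i => (e i).natAbs : ℕ) : ℝ)) ^ (1 : ℕ) *
            Real.log (max 3 (∏ i, ((q i : ℕ) : ℝ))) ^ (1 : ℕ)) := by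
  rintro ⟨c₅, h₃⟩ ⟨c₅', h₁⟩
  refine ⟨2, 2 * max 1 (max |c₅| |c₅'|), by norm_num, ?_, fun p hp hp2 => ?_⟩
  · have : (1 : ℝ) ≤ max 1 (max |c₅| |c₅'|) := le_max_left _ _
    linarith
  · exact finBoundAt_of_residueClasses h₃ h₁ hp hp2

end YuNinetyOdd

end Summit.ABC.StewartYu

end
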